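import Literature.NumberTheory.Transcendental.ZudilinSaddleCertificates
import Mathlib.Analysis.Complex.Polynomial.Basic
import Mathlib.Analysis.Calculus.Deriv.MeanValue
import HarnessLib

/-!
# The saddle point of Zudilin's phase: existence, uniqueness, enclosure, and the descent line

Topic `Literature/NumberTheory/Transcendental`; continues `ZudilinPhase.lean` and the certificate
files `ZudilinSaddleNumerics.lean`, `ZudilinSaddleCertificates.lean`. Everything here is PROVED;
no definitions, no named facts.

From the kernel certificates we derive what the Laplace method needs about
`Φ = Zudilin2004.phase` at `κ₀ = Zudilin2004.saddle` and along the vertical line `re κ = x₀`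
([Zudilin2004, §8 Lemma 20 and proof of Thm. 3]: `τ₀`, `C₀ = 227.58019641…`):

* `exists_root_near` — if `2^N ‖f(z)‖ < ‖f(w)‖` with `‖w − z‖ ≤ D` and `deg f ≤ N`, the complex
  polynomial `f` has a root within `D` of `z`;
* `Zudilin2004.saddle_spec'` — `saddle ∈ saddleBox ∧ Φ'(saddle) = 0` (the hypothesis of
  `Zudilin2004.saddle_spec` discharged), `Zudilin2004.dphase_injOn_saddleBox` (uniqueness, from
  `re Φ'' > 0` on the box), `Zudilin2004.norm_saddle_sub_kApprox_le` (`‖κ₀ − κ̃‖ ≤ 2^{−60}`),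
  `Zudilin2004.x0_bounds`, `Zudilin2004.u0_bounds`;
* `Zudilin2004.re_ddphase_saddle_ge` (`re Φ''(κ₀) ≥ 3/5`), `Zudilin2004.re_phase_saddle_le`
  (`Re Φ(κ₀) ≤ −227.58`), `Zudilin2004.sin_im_phase_saddle_pos` (`sin Im Φ(κ₀) > 0`);
* the vertical line through the saddle: `hasDerivAt_re_phase_vline` (`∂_t Re Φ(x+it) = −Im Φ'`),
  `hasDerivAt_neg_im_dphase_vline` (`∂_t (−Im Φ') = −Re Φ''`), `im_dphase_pos_of_ge`
  (`Im Φ'(x + it) > 0` for `t ≥ 26`, elementary), and on the line `re κ = x₀`: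
  `im_dphase_x0_pos` / `im_dphase_x0_neg` (sign of `Im Φ'` above/below `u₀`),
  `re_phase_x0_mono` / `re_phase_x0_anti` (`Re Φ(x₀ + it)` increases on `(0, u₀]`, decreases on
  `[u₀, ∞)`), `re_phase_x0_le_sub_sq` (strong concavity `Re Φ ≤ Re Φ(κ₀) − (3/10)(t−u₀)²` for
  `|t − u₀| ≤ 1/4`) and `re_phase_x0_gap` (`Re Φ(x₀+it) ≤ Re Φ(κ₀) − (3/10)d²` for `|t−u₀| ≥ d`,
  `0 < d ≤ 1/4`).

## References

* [Zudilin2004] W. Zudilin, J. Théor. Nombres Bordeaux 16 (2004), §8, Lemma 20, proof of Thm. 3.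
-/

noncomputable section

open Complex Finset Filter Polynomial Set
open scoped Real Topology ComplexConjugate
open Literature.Analysis.ValidatedNumerics.NumericsMP

namespace Literature.NumberTheory.Transcendental

/-! ### Roots of a complex polynomial near a point where it is small -/

/-- If every root is at distance `≥ D` from `z` and `‖w − z‖ ≤ D`, then
`‖∏ (w − r)‖ ≤ 2^{#roots} ‖∏ (z − r)‖`. [folklore] -/
theorem norm_multiset_prod_sub_le (s : Multiset ℂ) {z w : ℂ} {D : ℝ} (hw : ‖w - z‖ ≤ D)
    (hfar : ∀ r ∈ s, D ≤ ‖z - r‖) :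
    ‖(s.map fun r ↦ w - r).prod‖ ≤ 2 ^ Multiset.card s * ‖(s.map fun r ↦ z - r).prod‖ := by
  induction s using Multiset.induction_on with
  | empty => simp
  | cons a s ih =>
    simp only [Multiset.map_cons, Multiset.prod_cons, Multiset.card_cons, norm_mul, pow_succ]
    have ha : ‖w - a‖ ≤ 2 * ‖z - a‖ := by
      have h1 : ‖w - a‖ ≤ ‖w - z‖ + ‖z - a‖ := norm_sub_le_norm_sub_add_norm_sub _ _ _
      have h2 := hfar a (Multiset.mem_cons_self a s)
      linarith
    have ih' := ih fun r hr ↦ hfar r (Multiset.mem_cons_of_mem hr)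
    calc ‖w - a‖ * ‖(s.map fun r ↦ w - r).prod‖
        ≤ (2 * ‖z - a‖) * (2 ^ Multiset.card s * ‖(s.map fun r ↦ z - r).prod‖) :=
          mul_le_mul ha ih' (norm_nonneg _) (by positivity)
      _ = 2 ^ Multiset.card s * 2 * (‖z - a‖ * ‖(s.map fun r ↦ z - r).prod‖) := by ring

/-- **A root near a point where the polynomial is comparatively small.** If `deg f ≤ N`,
`‖w − z‖ ≤ D` and `2^N ‖f(z)‖ < ‖f(w)‖`, then `f` has a root `r` with `‖z − r‖ < D`
(`f(w)/f(z) = ∏ (w − rⱼ)/(z − rⱼ)` has modulus `≤ 2^{deg f}` if all roots are `D`-far from `z`).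
[folklore] -/
theorem exists_root_near {f : ℂ[X]} {z w : ℂ} {D : ℝ} {N : ℕ} (hw : ‖w - z‖ ≤ D)
    (hdeg : f.natDegree ≤ N) (hlt : 2 ^ N * ‖f.eval z‖ < ‖f.eval w‖) :
    ∃ r ∈ f.roots, ‖z - r‖ < D := by
  by_contra hcon
  simp only [not_exists, not_and, not_lt] at hcon
  have hs : f.Splits := IsAlgClosed.splits f
  have hprod := norm_multiset_prod_sub_le f.roots hw hcon
  have hcard : Multiset.card f.roots ≤ N := (Polynomial.card_roots' f).trans hdeg
  have hle : ‖f.eval w‖ ≤ 2 ^ N * ‖f.eval z‖ := by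
    rw [hs.eval_eq_prod_roots z, hs.eval_eq_prod_roots w, norm_mul, norm_mul]
    calc ‖f.leadingCoeff‖ * ‖(f.roots.map fun r ↦ w - r).prod‖
        ≤ ‖f.leadingCoeff‖ * (2 ^ Multiset.card f.roots * ‖(f.roots.map fun r ↦ z - r).prod‖) :=
          mul_le_mul_of_nonneg_left hprod (norm_nonneg _)
      _ ≤ ‖f.leadingCoeff‖ * (2 ^ N * ‖(f.roots.map fun r ↦ z - r).prod‖) :=
          mul_le_mul_of_nonneg_left (mul_le_mul_of_nonneg_right
            (pow_le_pow_right₀ (by norm_num : (1 : ℝ) ≤ 2) hcard) (norm_nonneg _)) (norm_nonneg _)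
      _ = 2 ^ N * (‖f.leadingCoeff‖ * ‖(f.roots.map fun r ↦ z - r).prod‖) := by ring
  linarith

namespace Zudilin2004

open SaddleNum

/-! ### A zero of `Φ'` within `2^{−60}` of `κ̃` -/

/-- **`Q` has a root within `2^{−60}` of `κ̃`.** [cite: Zudilin2004, §8 proof of Thm. 3] -/
theorem exists_saddleQ_root : ∃ r : ℂ, ‖r - kApprox‖ ≤ (2 : ℝ) ^ (-60 : ℤ) ∧ saddleQ r = 0 := by
  set f : ℂ[X] := X ^ 3 * (X + C 64) ^ 3 * (∏ u ∈ Icc (1 : ℕ) 10, (X + C (12 - (u : ℂ)))) -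
    (X - C 27) ^ 3 * (X + C 37) ^ 3 * ∏ u ∈ Icc (1 : ℕ) 10, (X + C (25 + (u : ℂ))) with hf
  have heval : ∀ z, f.eval z = saddleQ z := fun z ↦ by
    simp only [hf, saddleQ, eval_sub, eval_mul, eval_pow, eval_X, eval_add, eval_C, eval_prod]
    ring_nf
  have hdeg : f.natDegree ≤ 16 := by
    have hA : (X ^ 3 * (X + C 64) ^ 3 * ∏ u ∈ Icc (1 : ℕ) 10, (X + C (12 - (u : ℂ)))).natDegree ≤ 16 := by
      refine natDegree_mul_le.trans ?_
      have h1 : (X ^ 3 * (X + C (64 : ℂ)) ^ 3).natDegree ≤ 6 := by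
        refine natDegree_mul_le.trans ?_
        have := natDegree_pow_le (p := (X : ℂ[X])) (n := 3)
        have := natDegree_pow_le (p := (X + C (64 : ℂ))) (n := 3)
        rw [natDegree_X_add_C] at this
        have hX : (X : ℂ[X]).natDegree ≤ 1 := natDegree_X_le
        nlinarith
      have h2 : (∏ u ∈ Icc (1 : ℕ) 10, (X + C (12 - (u : ℂ)))).natDegree ≤ 10 := by
        refine (natDegree_prod_le _ _).trans ?_
        refine (Finset.sum_le_sum fun (u : ℕ) _ ↦ (natDegree_X_add_C (12 - (u : ℂ))).le).trans ?_
        simp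
      omega
    have hB : ((X - C 27) ^ 3 * (X + C 37) ^ 3 * ∏ u ∈ Icc (1 : ℕ) 10, (X + C (25 + (u : ℂ)))).natDegree ≤ 16 := by
      refine natDegree_mul_le.trans ?_
      have h1 : ((X - C (27 : ℂ)) ^ 3 * (X + C (37 : ℂ)) ^ 3).natDegree ≤ 6 := by
        refine natDegree_mul_le.trans ?_
        have h3 := natDegree_pow_le (p := (X - C (27 : ℂ))) (n := 3)
        have h4 := natDegree_pow_le (p := (X + C (37 : ℂ))) (n := 3)
        rw [natDegree_X_sub_C] at h3
        rw [natDegree_X_add_C] at h4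
        omega
      have h2 : (∏ u ∈ Icc (1 : ℕ) 10, (X + C (25 + (u : ℂ)))).natDegree ≤ 10 := by
        refine (natDegree_prod_le _ _).trans ?_
        refine (Finset.sum_le_sum fun (u : ℕ) _ ↦ (natDegree_X_add_C (25 + (u : ℂ))).le).trans ?_
        simp
      omega
    rw [hf]
    exact (natDegree_sub_le _ _).trans (max_le hA hB)
  have hw : ‖(kApprox + ((2 : ℝ) ^ (-60 : ℤ) : ℝ)) - kApprox‖ ≤ (2 : ℝ) ^ (-60 : ℤ) := by
    rw [add_sub_cancel_left, Complex.norm_real, Real.norm_eq_abs, abs_of_pos (by positivity)]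
  have hlt : 2 ^ 16 * ‖f.eval kApprox‖ < ‖f.eval (kApprox + ((2 : ℝ) ^ (-60 : ℤ) : ℝ))‖ := by
    rw [heval, heval]
    have h := normSq_saddleQ_shift_gt
    rw [Complex.normSq_eq_norm_sq, Complex.normSq_eq_norm_sq] at h
    have h' : (2 ^ 16 * ‖saddleQ kApprox‖) ^ 2 < ‖saddleQ (kApprox + ((2 : ℝ) ^ (-60 : ℤ) : ℝ))‖ ^ 2 := by
      nlinarith
    exact lt_of_pow_lt_pow_left₀ 2 (norm_nonneg _) h'
  obtain ⟨r, hr, hdist⟩ := exists_root_near hw hdeg hlt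
  refine ⟨r, ?_, ?_⟩
  · rw [norm_sub_rev]; exact hdist.le
  · rw [← heval]; exact Polynomial.isRoot_of_mem_roots hr

/-- Points within `2^{−60}` of `κ̃` are in `saddleBox`. [folklore] -/
theorem mem_saddleBox_of_near {r : ℂ} (hr : ‖r - kApprox‖ ≤ (2 : ℝ) ^ (-60 : ℤ)) : r ∈ saddleBox := by
  have hre := (abs_re_le_norm (r - kApprox)).trans hr
  have him := (abs_im_le_norm (r - kApprox)).trans hr
  rw [sub_re, kApprox_re, pRe, abs_le] at hre
  rw [sub_im, kApprox_im, pIm, abs_le] at him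
  norm_num at hre him
  refine ⟨abs_le.2 ⟨?_, ?_⟩, abs_le.2 ⟨?_, ?_⟩⟩ <;> linarith [hre.1, hre.2, him.1, him.2]

/-- Points within `2^{−60}` of `κ̃` have positive imaginary part (`> 3`). [folklore] -/
theorem im_gt_of_near {r : ℂ} (hr : ‖r - kApprox‖ ≤ (2 : ℝ) ^ (-60 : ℤ)) : 3 < r.im := by
  have him := (abs_im_le_norm (r - kApprox)).trans hr
  rw [sub_im, kApprox_im, pIm, abs_le] at him
  norm_num at him
  linarith [him.1, him.2]

/-- **There is a zero of `Φ'` in `saddleBox`, within `2^{−60}` of `κ̃`.**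
[cite: Zudilin2004, §8 proof of Thm. 3] -/
theorem exists_dphase_zero_near :
    ∃ κ : ℂ, κ ∈ saddleBox ∧ dphase κ = 0 ∧ ‖κ - kApprox‖ ≤ (2 : ℝ) ^ (-60 : ℤ) := by
  obtain ⟨r, hr, hQ⟩ := exists_saddleQ_root
  refine ⟨r, mem_saddleBox_of_near hr, ?_, hr⟩
  refine dphase_eq_zero_of_saddleQ (by linarith [im_gt_of_near hr]) hQ ?_
  have h1 := norm_dphase_lt_one_of_mem_boxB (mem_boxB_of_norm hr)
  linarith [Real.pi_gt_three]

/-- **The saddle point exists**: `saddle ∈ saddleBox ∧ Φ'(saddle) = 0`.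
[cite: Zudilin2004, §8 Lemma 20] -/
theorem saddle_spec' : saddle ∈ saddleBox ∧ dphase saddle = 0 := by
  obtain ⟨κ, h1, h2, -⟩ := exists_dphase_zero_near
  exact saddle_spec ⟨κ, h1, h2⟩

/-! ### Uniqueness in the box -/

/-- Derivative of `Φ'` along a segment: `∂_t Φ'(z + t w) = Φ''(z + t w) · w` (`im > 0`). [folklore] -/
theorem hasDerivAt_dphase_segment {z w : ℂ} {t : ℝ} (h : 0 < (z + t * w).im) :
    HasDerivAt (fun s : ℝ ↦ dphase (z + s * w)) (ddphase (z + t * w) * w) t := by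
  have h1 : HasDerivAt (fun s : ℂ ↦ dphase (z + s * w)) (ddphase (z + t * w) * w) (t : ℂ) := by
    have hinner : HasDerivAt (fun s : ℂ ↦ z + s * w) w (t : ℂ) := by
      simpa using ((hasDerivAt_id (t : ℂ)).mul_const w).const_add z
    exact (hasDerivAt_dphase h).comp (t : ℂ) hinner
  exact h1.comp_ofReal

/-- Segments between points of `saddleBox` stay in `saddleBox`. [folklore] -/
theorem segment_mem_saddleBox {z₁ z₂ : ℂ} (h₁ : z₁ ∈ saddleBox) (h₂ : z₂ ∈ saddleBox) {t : ℝ}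
    (ht0 : 0 ≤ t) (ht1 : t ≤ 1) : z₁ + t * (z₂ - z₁) ∈ saddleBox := by
  obtain ⟨a1, b1⟩ := h₁
  obtain ⟨a2, b2⟩ := h₂
  rw [abs_le] at a1 b1 a2 b2
  constructor
  · rw [abs_le]
    simp only [add_re, mul_re, ofReal_re, ofReal_im, sub_re, zero_mul, sub_zero]
    constructor <;> nlinarith
  · rw [abs_le]
    simp only [add_im, mul_im, ofReal_re, ofReal_im, sub_im, zero_mul, add_zero]
    constructor <;> nlinarith

/-- **`Φ'` is injective on `saddleBox`** (`re Φ'' > 0` on the convex box).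
[cite: Zudilin2004, §8 proof of Thm. 3] -/
theorem dphase_injOn_saddleBox : Set.InjOn dphase saddleBox := by
  intro z₁ h₁ z₂ h₂ heq
  by_contra hne
  set w : ℂ := z₂ - z₁ with hw
  have hw0 : w ≠ 0 := sub_ne_zero.2 (Ne.symm hne)
  have hwpos : 0 < ‖w‖ ^ 2 := by positivity
  have him : ∀ t : ℝ, 0 ≤ t → t ≤ 1 → 0 < (z₁ + t * w).im := fun t ht0 ht1 ↦ by
    have := (segment_mem_saddleBox h₁ h₂ ht0 ht1).2
    rw [abs_le] at this
    linarith [this.1]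
  set g : ℝ → ℝ := fun t ↦ (conj w * dphase (z₁ + t * w)).re with hg
  have hderiv : ∀ t : ℝ, 0 ≤ t → t ≤ 1 →
      HasDerivAt g (‖w‖ ^ 2 * (ddphase (z₁ + t * w)).re) t := by
    intro t ht0 ht1
    have h1 := (hasDerivAt_dphase_segment (him t ht0 ht1)).const_mul (conj w)
    have h2 : HasDerivAt g (conj w * (ddphase (z₁ + t * w) * w)).re t :=
      Complex.reCLM.hasFDerivAt.comp_hasDerivAt t h1
    refine h2.congr_deriv ?_
    have e : conj w * (ddphase (z₁ + t * w) * w) = ddphase (z₁ + t * w) * (Complex.normSq w : ℂ) := by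
      rw [Complex.normSq_eq_conj_mul_self]; ring
    rw [e, Complex.normSq_eq_norm_sq]
    simp only [mul_re, ofReal_re, ofReal_im, mul_zero, sub_zero]
    ring
  have hcont : ContinuousOn g (Set.Icc 0 1) := fun t ht ↦
    (hderiv t ht.1 ht.2).continuousAt.continuousWithinAt
  obtain ⟨ξ, hξ, hslope⟩ := exists_hasDerivAt_eq_slope g (fun t ↦ ‖w‖ ^ 2 * (ddphase (z₁ + t * w)).re)
    zero_lt_one hcont (fun t ht ↦ hderiv t ht.1.le ht.2.le)
  have hg1 : g 1 = g 0 := by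
    simp only [hg, ofReal_one, one_mul, ofReal_zero, zero_mul, add_zero]
    rw [show z₁ + w = z₂ by rw [hw]; ring, heq]
  rw [hg1, sub_self, zero_div] at hslope
  have hξdd := re_ddphase_ge_of_mem_saddleBox (segment_mem_saddleBox h₁ h₂ hξ.1.le hξ.2.le)
  have hpos : 0 < ‖w‖ ^ 2 * (ddphase (z₁ + ξ * w)).re := mul_pos hwpos (by linarith)
  linarith

/-- **`‖κ₀ − κ̃‖ ≤ 2^{−60}`**: the saddle point chosen in `ZudilinPhase.lean` is the certified zero.
[cite: Zudilin2004, §8 proof of Thm. 3] -/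
theorem norm_saddle_sub_kApprox_le : ‖saddle - kApprox‖ ≤ (2 : ℝ) ^ (-60 : ℤ) := by
  obtain ⟨κ, h1, h2, h3⟩ := exists_dphase_zero_near
  have := dphase_injOn_saddleBox saddle_spec'.1 h1 (by rw [saddle_spec'.2, h2])
  rwa [this]

/-- `κ₀ ∈ boxB`. [folklore] -/
theorem saddle_mem_boxB : MC.mem SaddleNum.S saddle boxB := mem_boxB_of_norm norm_saddle_sub_kApprox_le

/-- `|x₀ − re κ̃| ≤ 2^{−60}`. [folklore] -/
theorem abs_x0_sub_le : |x0 - kApprox.re| ≤ (2 : ℝ) ^ (-60 : ℤ) := by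
  simpa [x0] using (abs_re_le_norm (saddle - kApprox)).trans norm_saddle_sub_kApprox_le

/-- `|u₀ − im κ̃| ≤ 2^{−60}`. [folklore] -/
theorem abs_u0_sub_le : |u0 - kApprox.im| ≤ (2 : ℝ) ^ (-60 : ℤ) := by
  simpa [u0] using (abs_im_le_norm (saddle - kApprox)).trans norm_saddle_sub_kApprox_le

/-- `23.47 ≤ x₀ ≤ 23.48`. [cite: Zudilin2004, §8 proof of Thm. 3] -/
theorem x0_bounds : (2347 : ℝ) / 100 ≤ x0 ∧ x0 ≤ 2348 / 100 := by
  have h := abs_x0_sub_le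
  rw [kApprox_re, pRe, abs_le] at h
  norm_num at h ⊢
  constructor <;> linarith [h.1, h.2]

/-- `3.32 ≤ u₀ ≤ 3.33`. [cite: Zudilin2004, §8 proof of Thm. 3] -/
theorem u0_bounds : (332 : ℝ) / 100 ≤ u0 ∧ u0 ≤ 333 / 100 := by
  have h := abs_u0_sub_le
  rw [kApprox_im, pIm, abs_le] at h
  norm_num at h ⊢
  constructor <;> linarith [h.1, h.2]

/-- `0 < u₀`. [folklore] -/
theorem u0_pos : 0 < u0 := by linarith [u0_bounds.1]

/-- `κ₀ = x₀ + i u₀`. [folklore] -/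
theorem x0_add_u0_I : (x0 : ℂ) + u0 * I = saddle := by
  apply Complex.ext <;> simp [x0, u0]

/-- **`re Φ''(κ₀) ≥ 3/5`** (numerically `0.70734…`). [cite: Zudilin2004, §8 proof of Thm. 3] -/
theorem re_ddphase_saddle_ge : 3 / 5 ≤ (ddphase saddle).re :=
  re_ddphase_ge_of_mem_saddleBox saddle_spec'.1

/-- **`Re Φ(κ₀) ≤ −227.58`** (`C₀ = 227.58019641…`). [cite: Zudilin2004, §8 proof of Thm. 3] -/
theorem re_phase_saddle_le : (phase saddle).re ≤ -(22758 / 100) :=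
  re_phase_le_of_mem_boxB saddle_mem_boxB

/-- **`sin (Im Φ(κ₀)) > 0`**: `Im Φ(κ₀) ∈ 58π + (1/5, 1/2)`, so the oscillating factor
`Im e^{n Φ(κ₀)}` does not degenerate. [cite: Zudilin2004, §8 proof of Thm. 3] -/
theorem sin_im_phase_saddle_pos : 0 < Real.sin (phase saddle).im := by
  obtain ⟨h1, h2⟩ := im_phase_bounds_of_mem_boxB saddle_mem_boxB
  rw [← Real.sin_sub_int_mul_two_pi _ 29]
  push_cast
  refine Real.sin_pos_of_pos_of_lt_pi (by linarith) ?_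
  linarith [Real.pi_gt_three]

/-! ### The vertical line `re κ = x` -/

/-- `∂_t Φ(x + it) = Φ'(x + it) · i` (`t > 0`). [folklore] -/
theorem hasDerivAt_phase_vline {x t : ℝ} (ht : 0 < t) :
    HasDerivAt (fun s : ℝ ↦ phase ((x : ℂ) + s * I)) (dphase ((x : ℂ) + t * I) * I) t := by
  have h1 : HasDerivAt (fun s : ℂ ↦ phase (x + s * I)) (dphase ((x : ℂ) + t * I) * I) (t : ℂ) := by
    have hinner : HasDerivAt (fun s : ℂ ↦ (x : ℂ) + s * I) I (t : ℂ) := by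
      simpa using ((hasDerivAt_id (t : ℂ)).mul_const I).const_add (x : ℂ)
    exact (hasDerivAt_phase (by simp [ht])).comp (t : ℂ) hinner
  exact h1.comp_ofReal

/-- `∂_t Φ'(x + it) = Φ''(x + it) · i` (`t > 0`). [folklore] -/
theorem hasDerivAt_dphase_vline {x t : ℝ} (ht : 0 < t) :
    HasDerivAt (fun s : ℝ ↦ dphase ((x : ℂ) + s * I)) (ddphase ((x : ℂ) + t * I) * I) t := by
  have := hasDerivAt_dphase_segment (z := (x : ℂ)) (w := I) (t := t) (by simp [ht])
  simpa using this

/-- **`∂_t Re Φ(x + it) = −Im Φ'(x + it)`** (`t > 0`). [folklore] -/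
theorem hasDerivAt_re_phase_vline {x t : ℝ} (ht : 0 < t) :
    HasDerivAt (fun s : ℝ ↦ (phase ((x : ℂ) + s * I)).re) (-(dphase ((x : ℂ) + t * I)).im) t := by
  have h := Complex.reCLM.hasFDerivAt.comp_hasDerivAt t (hasDerivAt_phase_vline (x := x) ht)
  refine h.congr_deriv ?_
  simp

/-- **`∂_t (−Im Φ'(x + it)) = −Re Φ''(x + it)`** (`t > 0`). [folklore] -/
theorem hasDerivAt_neg_im_dphase_vline {x t : ℝ} (ht : 0 < t) :
    HasDerivAt (fun s : ℝ ↦ -(dphase ((x : ℂ) + s * I)).im) (-(ddphase ((x : ℂ) + t * I)).re) t := by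
  have h := (Complex.imCLM.hasFDerivAt.comp_hasDerivAt t (hasDerivAt_dphase_vline (x := x) ht)).neg
  refine h.congr_deriv ?_
  simp

/-- `|arctan a − arctan b| ≤ |a − b|`. [folklore] -/
theorem abs_arctan_sub_arctan_le (a b : ℝ) : |Real.arctan a - Real.arctan b| ≤ |a - b| := by
  have h := Convex.norm_image_sub_le_of_norm_hasDerivWithin_le (f := Real.arctan)
    (f' := fun x ↦ 1 / (1 + x ^ 2)) (s := Set.univ) (C := 1)
    (fun x _ ↦ (Real.hasDerivAt_arctan x).hasDerivWithinAt)
    (fun x _ ↦ by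
      rw [Real.norm_eq_abs, abs_of_pos (by positivity)]
      exact div_le_one_of_le₀ (by nlinarith) (by positivity))
    convex_univ (Set.mem_univ b) (Set.mem_univ a)
  simpa [Real.norm_eq_abs] using h

/-- `Im Φ'(x + it)` in terms of arctangents (`t > 0`):
`Im Φ' = 2π − 3(h 0 − h(−27)) − 3(h 64 − h 37) + Σ_u (h(25+u) − h(12−u))`, `h a = arctan ((x+a)/t)`.
[cite: Zudilin2004, §8 Lemma 20] -/
theorem im_dphase_vline {x t : ℝ} (ht : 0 < t) :
    (dphase ((x : ℂ) + t * I)).im = 2 * Real.pi -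
      3 * (Real.arctan (x / t) - Real.arctan ((x - 27) / t)) -
      3 * (Real.arctan ((x + 64) / t) - Real.arctan ((x + 37) / t)) +
      ∑ u ∈ Icc (1 : ℕ) 10, (Real.arctan ((x + 25 + u) / t) - Real.arctan ((x + 12 - u) / t)) := by
  have harg : ∀ a : ℝ, (log ((x : ℂ) + t * I + a)).im = Real.pi / 2 - Real.arctan ((x + a) / t) := by
    intro a
    rw [Complex.log_im, arg_eq_pi_div_two_sub_arctan (by simp [ht])]
    simp
  have h0 : (log ((x : ℂ) + t * I)).im = Real.pi / 2 - Real.arctan (x / t) := by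
    simpa using harg 0
  have h27 : (log ((x : ℂ) + t * I - 27)).im = Real.pi / 2 - Real.arctan ((x - 27) / t) := by
    have := harg (-27); push_cast at this; rw [← sub_eq_add_neg] at this; rw [this]; ring_nf
  have h64 : (log ((x : ℂ) + t * I + 64)).im = Real.pi / 2 - Real.arctan ((x + 64) / t) := by
    simpa using harg 64
  have h37 : (log ((x : ℂ) + t * I + 37)).im = Real.pi / 2 - Real.arctan ((x + 37) / t) := by
    simpa using harg 37
  have h25 : ∀ u : ℕ, (log ((x : ℂ) + t * I + 25 + (u : ℂ))).im =
      Real.pi / 2 - Real.arctan ((x + 25 + u) / t) := fun u ↦ by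
    have := harg (25 + u); push_cast at this; rw [← add_assoc] at this; rw [this]; ring_nf
  have h12 : ∀ u : ℕ, (log ((x : ℂ) + t * I + 12 - (u : ℂ))).im =
      Real.pi / 2 - Real.arctan ((x + 12 - u) / t) := fun u ↦ by
    have := harg (12 - u); push_cast at this; rw [← add_sub_assoc] at this; rw [this]; ring_nf
  unfold dphase
  simp only [add_im, sub_im, Complex.im_sum, mul_im, mul_re, re_ofNat, im_ofNat, zero_mul,
    add_zero, h0, h27, h64, h37, h25, h12, Complex.I_im, Complex.I_re, mul_one, mul_zero,
    ofReal_re, ofReal_im, sub_zero, Finset.sum_sub_distrib, Finset.sum_const, Nat.card_Icc]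
  ring

/-- **`Im Φ'(x + it) > 0` for `t ≥ 26`** (elementary: the denominator blocks contribute
nonnegatively and each numerator block at most `81/t`, while `2π > 162/26`).
[cite: Zudilin2004, §8 Lemma 20] -/
theorem im_dphase_pos_of_ge {x t : ℝ} (ht : 26 ≤ t) : 0 < (dphase ((x : ℂ) + t * I)).im := by
  have ht0 : 0 < t := by linarith
  rw [im_dphase_vline ht0]
  have hsum : 0 ≤ ∑ u ∈ Icc (1 : ℕ) 10,
      (Real.arctan ((x + 25 + u) / t) - Real.arctan ((x + 12 - u) / t)) := by
    refine Finset.sum_nonneg fun u _ ↦ ?_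
    have : (x + 12 - u) / t ≤ (x + 25 + u) / t :=
      div_le_div_of_nonneg_right (by linarith [(u.cast_nonneg : (0 : ℝ) ≤ u)]) ht0.le
    linarith [Real.arctan_mono this]
  have h1 : Real.arctan (x / t) - Real.arctan ((x - 27) / t) ≤ 27 / t := by
    have := abs_arctan_sub_arctan_le (x / t) ((x - 27) / t)
    rw [show x / t - (x - 27) / t = 27 / t by field_simp; ring] at this
    rw [abs_of_pos (by positivity : (0 : ℝ) < 27 / t)] at this
    exact (le_abs_self _).trans this
  have h2 : Real.arctan ((x + 64) / t) - Real.arctan ((x + 37) / t) ≤ 27 / t := by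
    have := abs_arctan_sub_arctan_le ((x + 64) / t) ((x + 37) / t)
    rw [show (x + 64) / t - (x + 37) / t = 27 / t by field_simp; ring] at this
    rw [abs_of_pos (by positivity : (0 : ℝ) < 27 / t)] at this
    exact (le_abs_self _).trans this
  have h3 : 27 / t ≤ 27 / 26 := div_le_div_of_nonneg_left (by norm_num) (by norm_num) ht
  have hpi := Real.pi_gt_d2
  linarith

/-! ### The line `re κ = x₀`: signs of `Im Φ'`, monotonicity and concavity of `Re Φ` -/

/-- `re Φ''(x₀ + it) > 0` for `0 < t ≤ 32`. [cite: Zudilin2004, §8 Lemma 20] -/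
theorem re_ddphase_x0_pos {t : ℝ} (ht0 : 0 ≤ t) (ht : t ≤ 32) : 0 < (ddphase ((x0 : ℂ) + t * I)).re :=
  re_ddphase_pos_line (by simpa using abs_x0_sub_le) (by simp [ht0]) (by simpa using ht)

/-- `−Im Φ'(x₀ + it)` is strictly antitone on `[a, 32]` for `a > 0`. [folklore] -/
theorem strictAntiOn_neg_im_dphase_x0 {a : ℝ} (ha : 0 < a) :
    StrictAntiOn (fun s : ℝ ↦ -(dphase ((x0 : ℂ) + s * I)).im) (Set.Icc a 32) := by
  refine strictAntiOn_of_deriv_neg (convex_Icc a 32) ?_ ?_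
  · exact fun s hs ↦ (hasDerivAt_neg_im_dphase_vline (by linarith [hs.1])).continuousAt.continuousWithinAt
  · intro s hs
    rw [interior_Icc] at hs
    rw [(hasDerivAt_neg_im_dphase_vline (by linarith [hs.1])).deriv]
    linarith [re_ddphase_x0_pos (by linarith [hs.1]) hs.2.le]

/-- `Im Φ'(κ₀) = 0` on the line: `(dphase (x₀ + i u₀)).im = 0`. [folklore] -/
theorem im_dphase_x0_u0 : (dphase ((x0 : ℂ) + u0 * I)).im = 0 := by
  rw [x0_add_u0_I, saddle_spec'.2]; simp

/-- **`Im Φ'(x₀ + it) > 0` for `t > u₀`.** [cite: Zudilin2004, §8 Lemma 20] -/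
theorem im_dphase_x0_pos {t : ℝ} (ht : u0 < t) : 0 < (dphase ((x0 : ℂ) + t * I)).im := by
  by_cases h26 : 26 ≤ t
  · exact im_dphase_pos_of_ge h26
  · have hu := u0_bounds
    have hanti := strictAntiOn_neg_im_dphase_x0 u0_pos (a := u0)
      ⟨le_rfl, by linarith⟩ ⟨ht.le, by linarith⟩ ht
    dsimp only at hanti
    rw [im_dphase_x0_u0, neg_zero] at hanti
    linarith

/-- **`Im Φ'(x₀ + it) < 0` for `0 < t < u₀`.** [cite: Zudilin2004, §8 Lemma 20] -/
theorem im_dphase_x0_neg {t : ℝ} (ht0 : 0 < t) (ht : t < u0) : (dphase ((x0 : ℂ) + t * I)).im < 0 := by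
  have hu := u0_bounds
  have hanti := strictAntiOn_neg_im_dphase_x0 ht0 (a := t)
    ⟨le_rfl, by linarith⟩ ⟨ht.le, by linarith⟩ ht
  dsimp only at hanti
  rw [im_dphase_x0_u0, neg_zero] at hanti
  linarith

/-- **`Re Φ(x₀ + it)` is monotone on `(0, u₀]`.** [cite: Zudilin2004, §8 Lemma 20] -/
theorem re_phase_x0_mono : MonotoneOn (fun s : ℝ ↦ (phase ((x0 : ℂ) + s * I)).re) (Set.Ioc 0 u0) := by
  refine monotoneOn_of_deriv_nonneg (convex_Ioc 0 u0) ?_ ?_ ?_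
  · exact fun s hs ↦ (hasDerivAt_re_phase_vline hs.1).continuousAt.continuousWithinAt
  · exact fun s hs ↦ (hasDerivAt_re_phase_vline (by rw [interior_Ioc] at hs; exact hs.1)).differentiableAt.differentiableWithinAt
  · intro s hs
    rw [interior_Ioc] at hs
    rw [(hasDerivAt_re_phase_vline hs.1).deriv]
    linarith [im_dphase_x0_neg hs.1 hs.2]

/-- **`Re Φ(x₀ + it)` is antitone on `[u₀, ∞)`.** [cite: Zudilin2004, §8 Lemma 20] -/
theorem re_phase_x0_anti : AntitoneOn (fun s : ℝ ↦ (phase ((x0 : ℂ) + s * I)).re) (Set.Ici u0) := by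
  refine antitoneOn_of_deriv_nonpos (convex_Ici u0) ?_ ?_ ?_
  · exact fun s hs ↦ (hasDerivAt_re_phase_vline (by linarith [u0_pos, hs.out])).continuousAt.continuousWithinAt
  · exact fun s hs ↦ (hasDerivAt_re_phase_vline (by rw [interior_Ici] at hs; linarith [u0_pos, hs.out])).differentiableAt.differentiableWithinAt
  · intro s hs
    rw [interior_Ici] at hs
    rw [(hasDerivAt_re_phase_vline (by linarith [u0_pos, hs.out])).deriv]
    linarith [im_dphase_x0_pos hs.out]

/-- **Strong concavity at the saddle**: `Re Φ(x₀ + it) ≤ Re Φ(κ₀) − (3/10)(t − u₀)²` for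
`|t − u₀| ≤ 1/4` (`re Φ'' ≥ 3/5` there). [cite: Zudilin2004, §8 proof of Thm. 3] -/
theorem re_phase_x0_le_sub_sq {t : ℝ} (ht : |t - u0| ≤ 1 / 4) :
    (phase ((x0 : ℂ) + t * I)).re ≤ (phase saddle).re - 3 / 10 * (t - u0) ^ 2 := by
  have hu := u0_bounds
  rw [abs_le] at ht
  -- `F(s) = Re Φ(x₀ + is) + (3/10)(s − u₀)²`, `F' = −Im Φ' + (3/5)(s − u₀)` is antitone on the window
  set F : ℝ → ℝ := fun s ↦ (phase ((x0 : ℂ) + s * I)).re + 3 / 10 * (s - u0) ^ 2 with hF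
  set F' : ℝ → ℝ := fun s ↦ -(dphase ((x0 : ℂ) + s * I)).im + 3 / 5 * (s - u0) with hF'
  have hdd : ∀ s, u0 - 1 / 4 ≤ s → s ≤ u0 + 1 / 4 → 3 / 5 ≤ (ddphase ((x0 : ℂ) + s * I)).re := by
    intro s h1 h2
    refine re_ddphase_ge_near (by simpa using abs_x0_sub_le) ?_
    have hu0 := abs_u0_sub_le
    have e : ((x0 : ℂ) + s * I).im = s := by simp
    rw [e]
    rw [abs_le] at hu0 ⊢
    norm_num at hu0 ⊢
    constructor <;> linarith [hu0.1, hu0.2]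
  have hFd : ∀ s, u0 - 1 / 4 ≤ s → s ≤ u0 + 1 / 4 → HasDerivAt F (F' s) s := by
    intro s h1 h2
    have hs : 0 < s := by linarith
    have := (hasDerivAt_re_phase_vline (x := x0) hs).add
      (((hasDerivAt_id s).sub_const u0).pow 2 |>.const_mul (3 / 10))
    refine this.congr_deriv ?_
    simp only [hF', id_eq]
    ring
  have hF'd : ∀ s, u0 - 1 / 4 ≤ s → s ≤ u0 + 1 / 4 →
      HasDerivAt F' (-(ddphase ((x0 : ℂ) + s * I)).re + 3 / 5) s := by
    intro s h1 h2
    have hs : 0 < s := by linarith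
    have := (hasDerivAt_neg_im_dphase_vline (x := x0) hs).add
      (((hasDerivAt_id s).sub_const u0).const_mul (3 / 5))
    refine this.congr_deriv ?_
    simp
  -- `F'` is antitone on the window and vanishes at `u₀`
  have hanti : AntitoneOn F' (Set.Icc (u0 - 1 / 4) (u0 + 1 / 4)) := by
    refine antitoneOn_of_deriv_nonpos (convex_Icc _ _) ?_ ?_ ?_
    · exact fun s hs ↦ (hF'd s hs.1 hs.2).continuousAt.continuousWithinAt
    · intro s hs
      rw [interior_Icc] at hs
      exact (hF'd s hs.1.le hs.2.le).differentiableAt.differentiableWithinAt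
    · intro s hs
      rw [interior_Icc] at hs
      rw [(hF'd s hs.1.le hs.2.le).deriv]
      linarith [hdd s hs.1.le hs.2.le]
  have hF'0 : F' u0 = 0 := by simp [hF', im_dphase_x0_u0]
  -- hence `F` is maximal at `u₀` on the window
  have hFcont : ∀ s, u0 - 1 / 4 ≤ s → s ≤ u0 + 1 / 4 → ContinuousWithinAt F (Set.Icc (u0 - 1 / 4) (u0 + 1 / 4)) s :=
    fun s h1 h2 ↦ (hFd s h1 h2).continuousAt.continuousWithinAt
  have key : F t ≤ F u0 := by
    rcases le_or_gt t u0 with hle | hgt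
    · -- on `[t, u₀]`, `F' ≥ 0`, so `F` is monotone
      have hmono : MonotoneOn F (Set.Icc (u0 - 1 / 4) u0) := by
        refine monotoneOn_of_deriv_nonneg (convex_Icc _ _) ?_ ?_ ?_
        · exact fun s hs ↦ (hFd s hs.1 (by linarith [hs.2])).continuousAt.continuousWithinAt
        · intro s hs
          rw [interior_Icc] at hs
          exact (hFd s hs.1.le (by linarith [hs.2])).differentiableAt.differentiableWithinAt
        · intro s hs
          rw [interior_Icc] at hs
          rw [(hFd s hs.1.le (by linarith [hs.2])).deriv, ← hF'0]
          exact hanti ⟨hs.1.le, by linarith [hs.2]⟩ ⟨by linarith, by linarith⟩ hs.2.le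
      exact hmono ⟨ht.1 |> fun h ↦ by linarith, hle⟩ ⟨by linarith, le_rfl⟩ hle
    · have hanti' : AntitoneOn F (Set.Icc u0 (u0 + 1 / 4)) := by
        refine antitoneOn_of_deriv_nonpos (convex_Icc _ _) ?_ ?_ ?_
        · exact fun s hs ↦ (hFd s (by linarith [hs.1]) hs.2).continuousAt.continuousWithinAt
        · intro s hs
          rw [interior_Icc] at hs
          exact (hFd s (by linarith [hs.1]) hs.2.le).differentiableAt.differentiableWithinAt
        · intro s hs
          rw [interior_Icc] at hs
          rw [(hFd s (by linarith [hs.1]) hs.2.le).deriv, ← hF'0]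
          exact hanti ⟨by linarith, by linarith⟩ ⟨by linarith [hs.1], hs.2.le⟩ hs.1.le
      exact hanti' ⟨le_rfl, by linarith⟩ ⟨hgt.le, by linarith [ht.2]⟩ hgt.le
  have hFu0 : F u0 = (phase saddle).re := by simp [hF, x0_add_u0_I]
  rw [hFu0] at key
  simp only [hF] at key
  linarith

/-- **The gap away from the saddle**: for `0 < d ≤ 1/4`, `Re Φ(x₀ + it) ≤ Re Φ(κ₀) − (3/10) d²`
whenever `t > 0` and `|t − u₀| ≥ d`. [cite: Zudilin2004, §8 proof of Thm. 3] -/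
theorem re_phase_x0_gap {d t : ℝ} (hd : 0 < d) (hd' : d ≤ 1 / 4) (ht0 : 0 < t) (ht : d ≤ |t - u0|) :
    (phase ((x0 : ℂ) + t * I)).re ≤ (phase saddle).re - 3 / 10 * d ^ 2 := by
  have hu := u0_bounds
  rcases le_or_gt t u0 with hle | hgt
  · -- `t ≤ u₀ − d`: monotone up to `u₀ − d`, then strong concavity
    have ht' : t ≤ u0 - d := by
      rw [abs_of_nonpos (by linarith)] at ht; linarith
    have h1 := re_phase_x0_mono ⟨ht0, by linarith⟩ ⟨by linarith, by linarith⟩ ht'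
    have h2 := re_phase_x0_le_sub_sq (t := u0 - d) (by rw [abs_le]; constructor <;> linarith)
    simp only at h1
    nlinarith
  · have ht' : u0 + d ≤ t := by
      rw [abs_of_pos (by linarith)] at ht; linarith
    have h1 := re_phase_x0_anti (Set.mem_Ici.2 (by linarith : u0 ≤ u0 + d)) (Set.mem_Ici.2 hgt.le) ht'
    have h2 := re_phase_x0_le_sub_sq (t := u0 + d) (by rw [abs_le]; constructor <;> linarith)
    simp only at h1
    nlinarith

end Zudilin2004

end Literature.NumberTheory.Transcendental
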